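import Summits.BirchSwinnertonDyer.BirchSwinnertonDyer.Theorems.ClassRecordThreeEulerHalvesAtThreeKolyvaginFamilyLevelSupply
import Summits.BirchSwinnertonDyer.BirchSwinnertonDyer.Theorems.ClassRecordThreeEulerHalvesAtThreeKolyvaginFamilyStanding
import Summits.BirchSwinnertonDyer.BirchSwinnertonDyer.Theorems.ClassRecordThreeEulerHalvesAtThreeKolyvaginFamilyRootClass
import Summits.BirchSwinnertonDyer.BirchSwinnertonDyer.Theorems.ClassRecordThreeEulerHalvesAtThreeKolyvaginFamilyInvariance
import Summits.BirchSwinnertonDyer.BirchSwinnertonDyer.Theorems.ClassRecordThreeEulerHalvesAtThreeShimuraWalkEndGlueGross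
import Summits.BirchSwinnertonDyer.BirchSwinnertonDyer.Theorems.ClassRecordThreeCornerAtThreeShimuraSwapFamilyCebotarev
import Summits.BirchSwinnertonDyer.BirchSwinnertonDyer.Theorems.ClassRecordThreeCornerAtThreeShimuraFamilyTransverse
import Summits.BirchSwinnertonDyer.BirchSwinnertonDyer.Theorems.ClassRecordThreeCornerAtThreeShimuraWalkSplitCarrier
import Summits.BirchSwinnertonDyer.BirchSwinnertonDyer.Theorems.ClassRecordThreeCornerAtThreeShimuraInertDisplayOfPrimitives
import Summits.BirchSwinnertonDyer.BirchSwinnertonDyer.Theorems.Rank1ResidualJetKodairaNeronCyclic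
import HarnessLib

/-!
# THE END GAME OF `stub_levelSupplyAtThree` — `LevelSupplyAt hK ι W N 3 ys (ord₃ c_q(E))` on the target frame of `ShimuraWalk.LevelSupplyAtThreeB6`
# from the printed labels and THIS seat's (P2) walk assembly, with EVERY landed producer plugged in and the not-yet-landed ones DISPLAYED
# (cell `bsd-stepL`, seat `bsd-stepL-tam3-p1` g13, owner of 19109's line; `--supports stmt-BirchSwinnertonDyer-19109 --as helper`)

HONEST FRAMING. Nothing here proves BSD, J₃ or any divisibility of a CM ∕ Heegner point; the port target `LevelSupplyAtThreeB6` is NOT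
discharged; no item ∕ stub closes; 0 classes move (T7). ONE theorem + one private lemma (no definition, no named fact, no `sorry`); it is
CONDITIONAL on exactly the displayed hypotheses listed under STILL DISPLAYED.
WHAT. `levelSupplyAt_three_of_labels_of_familyProducers`: on the frame prefix of `ShimuraWalk.LevelSupplyAtThreeB6` (`W` globally minimal of
conductor `N`, `E[3]` irreducible, `K` imaginary quadratic, inert-unramified level set `S ∋ 3`, the other primes of `N` split, a modular
parametrisation `Dt`, an embedding `ι`, a labelled family `LabelsAt W N K ι y ys ε`) and at a prime `q ∉ S`, the per-level inequality
`LevelSupplyAt hK ι W N 3 ys (ord₃ c_q(E⁄ℚ_q))`. PLUGGED IN (tree theorems): the Gross END GLUE (p602391, `hB4` read off `LabelsAt`); the (P2)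
assembly `Koly.familyLevelSupply_of_memberships` with — carrier: the split place over `q` (corner3-p2's `exists_split_place_of_ncard_eq_two`)
and the (δ) data at every level from bsd-jet's `carrierRowData_of_split` ∕ `relIndex_stringentFamily_eq_pow` ∕ `isAddCyclic_kummer_quotient_stringentFamily`
∕ `conjActPlace_mem_stringentFamily` ∕ `kodairaNeron_isAddCyclic_forall` (`q ∣ N` because `3 ∣ c_q`; `t = 0` is the trivial case); Čebotarev AT
EVERY LEVEL `3^k` from corner3-p2's mod-3 image inputs on the carrier-inert frame (`kolyvaginImageInputs_three_of_mem_inertSet`) through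
corner-p1's `exists_grossKolyvaginPrime_addOrderOf_localization_eq_shift_ofImage`; `hA` ∕ `hAτ` (this seat's p603099, `E[3]` irreducible + the
Weil pairing `exists_weilPairing_holds` + `3` unramified in `K` from `3 ∈ S`); `hKum` (this seat's p603518 from the displayed `hSel`); `hP` (this seat's p604825 `familyInvariance_of_labelsAt`, from (B4)); `htr`
(corner3-p2's `rootClass_familyData_mem_transverseKer`, p603631); complex conjugation `τ ≠ 1` (`|Aut(K/ℚ)| = 2`).
STILL DISPLAYED (hypotheses, in the assembly's binder shapes at `p = 3`; lane B (corner3-p2 g8) delivers them from `LabelsAt` + `LabelB6`,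
the last three after its CHOICE-FREENESS lemma): `hPT` (Poitou–Tate for Selmer structures — in the r8 skeleton DERIVED from
`stub_localFactsAtThree.1`); `hD : d_K < −4` (FINDING: the target frame admits `K = ℚ(i)`; the tree's transverse self-duality is `d_K < −4`);
`hsign` (Gross 5.4 (1), (B3)+(B4) — tower form landed p600503); `hSel`
(Gross 6.2 (1) at the finite places off `n`, every `M ≥ 1` — tower form landed p600152); `hstrq` (Jetchev 4.9 at every place over `q` —
tower form landed p601311); `h47` (McCallum 4.4 in `addOrderOf ∘ loc_λ` form for ARBITRARY presentations at `n`, `nℓ` — coherent-tower form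
landed p601020). References (locators only): [cite: Jetchev2008, Thm. 1.4, §6 Thm. 6.3, Prop. 6.4, Lemma 6.1, Lemma 3.2] [cite: GrossLMS1991,
§3 (3.1)–(3.3), Prop. 3.7, §4, Prop. 5.4, §6 Prop. 6.2 (1)] [cite: McCallumLMS1991, §3 Cor. 3.2, §4 Prop. 4.4] [cite: Howard2004HeegnerKolyvagin,
Prop. 2.1.9, Lemma 2.7.3] [cite: CasselsFrohlichANT1967, Ch. VII Prop. 1.2 (ii)] [cite: SilvermanATAEC1994, Cor. IV.9.2].
presearch: not applicable (composition of tree theorems); `lean search 'levelSupplyAt_three_of'` → none.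
Design: `K : Type`. Axioms: `propext`, `Classical.choice`, `Quot.sound`.
-/

set_option autoImplicit false

noncomputable section

open scoped Classical NumberField Pointwise

namespace Summit.BirchSwinnertonDyer.Rank1Residual.X11b.Three.Koly

open WeierstrassCurve IsDedekindDomain NumberField Field Function Literature.NumberTheory.EllipticCurves
  Literature.NumberTheory.EllipticCurves.ModularForms Literature.NumberTheory.EllipticCurves.Jetchev2008
  Literature.NumberTheory.EllipticCurves.KolyvaginCocycle
  Literature.NumberTheory.EllipticCurves.Rank1Residual Literature.NumberTheory.GaloisRepresentations
  Literature.NumberTheory.GaloisCohomology Literature.NumberTheory.Automorphic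
  Summit.BirchSwinnertonDyer.Rank1Residual.JET Summit.BirchSwinnertonDyer.Rank1Residual.JET.SelmerVocabulary
  Summit.BirchSwinnertonDyer.Rank1Residual.JET.Walk Summit.BirchSwinnertonDyer.Rank1Residual.JET.GlobalDuality
  Summit.BirchSwinnertonDyer.BirchSwinnertonDyer.Theorems
open Summit.BirchSwinnertonDyer.BirchSwinnertonDyer.Theorems.ShimuraWalk (frobLevelIndex natCast_le_frobLevelIndex_iff
  LevelSupplyAt LabelsAt)

/-- An imaginary quadratic field has a `ℚ`-automorphism `≠ 1` (`|Aut(K/ℚ)| = [K : ℚ] = 2`). [folklore] -/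
private theorem exists_algEquiv_ne_one' (K : Type) [Field K] [NumberField K] (hK : IsImaginaryQuadratic K) :
    ∃ c : K ≃ₐ[ℚ] K, c ≠ 1 := by
  haveI : Algebra.IsQuadraticExtension ℚ K := ⟨hK.1⟩
  have hcard : Nat.card (K ≃ₐ[ℚ] K) = 2 := by rw [IsGalois.card_aut_eq_finrank, hK.1]
  haveI : Finite (K ≃ₐ[ℚ] K) := Nat.finite_of_card_ne_zero (by rw [hcard]; decide)
  haveI : Nontrivial (K ≃ₐ[ℚ] K) := Finite.one_lt_card_iff_nontrivial.mp (by rw [hcard]; decide)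
  exact exists_ne 1

set_option maxHeartbeats 800000 in
/-- **`LevelSupplyAt hK ι W N 3 ys (ord₃ c_q)` on the `LevelSupplyAtThreeB6` frame from the labels, the landed producers and the
displayed ones** (see the module docstring for the exact list). [cite: Jetchev2008, Thm. 1.4, Thm. 6.3, Prop. 6.4, Lemma 6.1]
[cite: GrossLMS1991, Prop. 5.4, §6 Prop. 6.2 (1)] [cite: McCallumLMS1991, §3 Cor. 3.2, §4 Prop. 4.4] -/
theorem levelSupplyAt_three_of_labels_of_familyProducers
    (W : WeierstrassCurve ℚ) [W.IsElliptic] [W.IsGloballyMinimal] (N : ℕ) [NeZero N]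
    (K : Type) [Field K] [NumberField K] (S : Finset ℕ)
    (Dt : ModularParametrizationData W N)
    (hN : W.conductorNorm ℤ = N) (hirr : W.HasIrreducibleModPGaloisRep 3)
    (hK : IsImaginaryQuadratic K) (hD : NumberField.discr K < -4)
    (hin : ∀ ℓ ∈ S, ℓ.Prime ∧ ℓ ∣ N ∧ ¬ ℓ ^ 2 ∣ N ∧
      ((Ideal.span {(ℓ : ℤ)}).primesOver (𝓞 K)).ncard = 1 ∧ ¬ (ℓ : ℤ) ∣ NumberField.discr K)
    (hsp : ∀ ℓ : ℕ, ℓ.Prime → ℓ ∣ N → ℓ ∉ S → ((Ideal.span {(ℓ : ℤ)}).primesOver (𝓞 K)).ncard = 2)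
    (h3S : 3 ∈ S)
    (ι : K →+* ℂ) [hRCF : ∀ j : ℕ, NumberField (ringClassField K ι j)]
    (hPT : ∀ (K : Type) [Field K] [NumberField K], poitouTate_selmerStructure_duality_conj K)
    (y : (W.baseChange K).toAffine.Point)
    (ys : (m : ℕ) → (W.baseChange (ringClassField K ι m)).toAffine.Point) (ε : ℤ)
    (hL : LabelsAt W N K ι y ys ε)
    (q : ℕ) [Fact q.Prime] (hqS : q ∉ S)
    -- the displayed family-specific producers (for EVERY datum; `p = 3`; lane B's ∀-datum deliveries)
    (hsign : ∀ (τ : K ≃ₐ[ℚ] K), τ ≠ 1 → ∀ (n : ℕ) (d : KolyvaginFamilyData W K ι n), d.y = ys n → Squarefree n →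
      (∀ q' ∈ n.primeFactors, IsKolyvaginPrime N W K 3 q') →
      ∀ j : ℕ, 1 ≤ j → (j : ℕ∞) ≤ frobLevelIndex W K 3 n →
      ∃ B ∈ d.pointsSubgroup, (isLiftOfAut_liftAut τ).pointsMap W (d.toGeomPoints d.derivedPoint) =
        (ε * (-1) ^ n.primeFactors.card) • d.toGeomPoints d.derivedPoint + ((3 ^ j : ℕ) : ℤ) • B)
    (hSel : ∀ (M n : ℕ) (d : KolyvaginFamilyData W K ι n), 1 ≤ M → d.y = ys n → Squarefree n →
      (∀ q' ∈ n.primeFactors, IsKolyvaginPrime N W K 3 q' ∧ FrobEqFrobInfty W K (3 ^ M) q') →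
      ∀ 𝔳 : HeightOneSpectrum (𝓞 K), (n : 𝓞 K) ∉ 𝔳.asIdeal →
        d.kolyvaginClass (Fact.out : (3 : ℕ).Prime) M ∈
          selmerLocalKer (W.baseChange K) (𝔳.adicCompletion K) ((3 ^ M : ℕ) : ℤ))
    (hstrq : ∀ (k : ℕ) (hn : ((3 ^ k : ℕ) : ℤ) ≠ 0) (n : ℕ) (d : KolyvaginFamilyData W K ι n), 1 ≤ k → d.y = ys n →
      Squarefree n →
      (∀ q' ∈ n.primeFactors, IsKolyvaginPrime N W K 3 q' ∧ FrobEqFrobInfty W K (3 ^ k) q') → n.primeFactors.Nonempty →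
      ∀ v : HeightOneSpectrum (𝓞 K), ((q : ℕ) : 𝓞 K) ∈ v.asIdeal →
        galoisCohomology.localization ((W.baseChange K).torsionGaloisModule ((3 ^ k : ℕ) : ℤ)) (Sum.inr v) 1
          (d.kolyvaginClass (Fact.out : (3 : ℕ).Prime) k) ∈ stringentFamily W K hn (Sum.inr v))
    (h47 : ∀ (k n n' : ℕ) (d : KolyvaginFamilyData W K ι n) (d' : KolyvaginFamilyData W K ι n') (ℓ : ℕ),
      1 ≤ k → d.y = ys n → d'.y = ys n' → Squarefree n →
      (∀ q' ∈ n'.primeFactors, IsKolyvaginPrime N W K 3 q' ∧ FrobEqFrobInfty W K (3 ^ k) q') →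
      ℓ.Prime → ¬ ℓ ∣ n → n' = n * ℓ →
      ∀ v : HeightOneSpectrum (𝓞 K), (ℓ : 𝓞 K) ∈ v.asIdeal →
      addOrderOf (galoisCohomology.localization ((W.baseChange K).torsionGaloisModule ((3 ^ k : ℕ) : ℤ))
          (Sum.inr v) 1 (d'.kolyvaginClass (Fact.out : (3 : ℕ).Prime) k)) =
        addOrderOf (galoisCohomology.localization ((W.baseChange K).torsionGaloisModule ((3 ^ k : ℕ) : ℤ))
          (Sum.inr v) 1 (d.kolyvaginClass (Fact.out : (3 : ℕ).Prime) k))) :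
    LevelSupplyAt hK ι W N 3 ys (padicValNat 3 ((W.baseChange ℚ_[q]).localTamagawaNumber ℤ_[q])) := by
  subst hN
  have hp : (3 : ℕ).Prime := Fact.out
  have hp2 : (3 : ℕ) ≠ 2 := by decide
  -- the trivial case `t = 0`
  rcases Nat.eq_zero_or_pos (padicValNat 3 ((W.baseChange ℚ_[q]).localTamagawaNumber ℤ_[q])) with ht0 | htpos
  · rw [ht0]
    intro k c _ _ _
    simp
  set t : ℕ := padicValNat 3 ((W.baseChange ℚ_[q]).localTamagawaNumber ℤ_[q]) with ht
  -- `3 ∣ c_q`, so `q` is a bad prime: `q ∣ N`, and (as `q ∉ S`) it splits in `K`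
  obtain ⟨vq, hqq⟩ : ∃ v : HeightOneSpectrum (𝓞 ℚ), (Rat.HeightOneSpectrum.primesEquiv v : ℕ) = q :=
    ⟨Rat.HeightOneSpectrum.primesEquiv.symm ⟨q, Fact.out⟩, by rw [Equiv.apply_symm_apply]⟩
  have hcq : (W.baseChange ℚ_[q]).localTamagawaNumber ℤ_[q] = W.tamagawaNumberAt vq :=
    WeierstrassCurve.localTamagawaNumber_padic_eq_holds W vq q hqq
  have hbad : ¬ W.HasGoodReductionAt vq := fun hgood ↦ by
    have h1 : W.tamagawaNumberAt vq = 1 :=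
      WeierstrassCurve.localTamagawaNumber_eq_one_of_hasGoodReductionAt_holds W vq hgood
    have : t = 0 := by rw [ht, hcq, h1, padicValNat_one_right]
    omega
  have hqN : q ∣ W.conductorNorm ℤ := by rw [← hqq]; exact (W.dvd_conductorNorm_iff vq).mpr hbad
  have hq2 := hsp q Fact.out hqN hqS
  -- complex conjugation and the carrier place `v₀ ∋ q` moved by it
  obtain ⟨τ, hτ⟩ := exists_algEquiv_ne_one' K hK
  obtain ⟨v₀, hv₀, hv₀N, hqv₀⟩ := ShimuraWalk.exists_split_place_of_ncard_eq_two K hK τ hτ q hq2 hqN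
  have hqv₀' : ((q : ℕ) : 𝓞 K) ∈ (τ • v₀).asIdeal := by
    have := (HeightOneSpectrum.smul_mem_smul_asIdeal_iff τ v₀ ((q : ℕ) : 𝓞 K)).mpr hqv₀
    rwa [GlobalDuality.smul_natCast_ringOfIntegers] at this
  have hv₀N' : ((W.conductorNorm ℤ : ℕ) : 𝓞 K) ∈ (τ • v₀).asIdeal := by
    have := (HeightOneSpectrum.smul_mem_smul_asIdeal_iff τ v₀ ((W.conductorNorm ℤ : ℕ) : 𝓞 K)).mpr hv₀N
    rwa [GlobalDuality.smul_natCast_ringOfIntegers] at this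
  -- the (δ) row data at `v₀` (Kodaira–Néron cyclicity transported from `ℚ_q`)
  obtain ⟨hminK, hminP, hcEq, hc0, hcyc⟩ := carrierRowData_of_split W K q hK τ v₀ hv₀ hqv₀
  haveI := hminK
  haveI := hminP
  have hpc : 3 ∣ (W.baseChange ℚ_[q]).localTamagawaNumber ℤ_[q] := dvd_of_one_le_padicValNat htpos
  haveI := hcyc (kodairaNeron_isAddCyclic_forall W q 3 hp2 hpc)
  have hfac : (((W.baseChange K).baseChange (v₀.adicCompletion K)).localTamagawaNumber
      (v₀.adicCompletionIntegers K)).factorization 3 = t := by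
    rw [hcEq, ht, Nat.factorization_def _ hp]
  -- the mod-3 image inputs on the carrier-inert frame, and Čebotarev at every level `3^k`
  obtain ⟨hIz, hIs, hIc, hIt⟩ :=
    ShimuraKolyvaginOfImage.kolyvaginImageInputs_three_of_mem_inertSet K W S rfl hirr hK hin hsp h3S
  -- `3` is unramified in `K` (`3 ∈ S`), the Weil pairing
  have hKunr := ShimuraKolyvaginOfImage.isUnramifiedIn_rat_of_not_dvd_discr K hp (hin 3 h3S).2.2.2.2
  have hW3 := WeierstrassCurve.exists_weilPairing_holds W 3
  -- admissibility for every datum of the family (`E[3]` irreducible; the levels are prime to `3`)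
  have hA : ∀ (n : ℕ) (d : KolyvaginFamilyData W K ι n), d.y = ys n → Squarefree n →
      (∀ q' ∈ n.primeFactors, IsKolyvaginPrime (W.conductorNorm ℤ) W K 3 q') →
      ∀ j : ℕ, IsAdmissible (absoluteGaloisGroup K) d.pointsSubgroup ((3 ^ j : ℕ) : ℤ) :=
    fun n d _ hn hKP j ↦ d.isAdmissible_pointsSubgroup_family_of_hasIrreducibleModPGaloisRep hK hn.ne_zero hp hp2
      hirr hW3 hKunr (fun h3n ↦ (hKP 3 (Nat.mem_primeFactors.mpr ⟨hp, h3n, hn.ne_zero⟩)).2.2.2.1 rfl) j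
  -- invariance of `[P_n]` mod `3^j`, `j ≤ M(n)`, for every datum (this seat's p604825, from (B4) of `LabelsAt`)
  have hP := familyInvariance_of_labelsAt W hK ι hp Dt ys hL
  -- the END GLUE over the (P2) assembly
  refine ShimuraWalk.levelSupplyAt_of_familyLevelSupplyGross hK ι Dt hp ys t ?_ ?_
  · -- `hB4` read off (B4) of `LabelsAt`
    intro k hk hKP ℓ hℓ σ hσ
    have hle : ringClassField K ι (k / ℓ) ≤ ringClassField K ι k :=
      ringClassField_mono hK ι (Nat.div_dvd_of_dvd (Nat.dvd_of_mem_primeFactors hℓ)) hk.ne_zero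
    exact ⟨_, hL.2.2.2.2.1 k hk (fun q' hq' ↦ ⟨(hKP q' hq').2.1, (hKP q' hq').2.2.2.2.1⟩) ℓ hℓ hle σ hσ⟩
  · refine familyLevelSupply_of_memberships W K hK hD ι 3 hp2 τ hτ hPT ys ε hL.1 t v₀ hv₀ hv₀N hv₀N'
      ?_ ?_ hA hP ?_ (hsign τ hτ) ?_ ?_ ?_ h47
    · -- the carrier's (δ) data at every level `3^k ≥ 3^t`
      intro _ k hn htk
      refine ⟨fun w ↦ stringentFamily_le_kummer W K hn w,
        fun v' w h _ x hx ↦ conjActPlace_mem_stringentFamily W τ hn h hx,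
        isAddCyclic_kummer_quotient_stringentFamily W K hn v₀, ?_⟩
      rw [← hfac]
      exact relIndex_stringentFamily_eq_pow W K hp k hn v₀ hc0 (by rw [hfac]; exact htk)
    · -- Čebotarev at level `3^k` from the mod-3 image inputs
      intro k hk j e he x y' hx hy hy0 b
      obtain ⟨ℓ, hbℓ, ⟨hKol, hfrob⟩, hord⟩ :=
        exists_grossKolyvaginPrime_addOrderOf_localization_eq_shift_ofImage W (N := W.conductorNorm ℤ) hK hp2
          hIz hIs hIc hIt τ hτ hk j he x y' hx hy hy0 b
      exact ⟨ℓ, hbℓ, hKol, hfrob, hord⟩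
    · -- `τ̃`-stability of `E(K[n]) ⊆ E(K̄)`
      intro n d _ hn
      exact d.pointsMap_mem_pointsSubgroup_family hK hn.ne_zero (isLiftOfAut_liftAut τ)
    · -- Kummer membership of the root classes off `n`
      exact familyRootKummer_of_selmerLocalKer W hK ι 3 ys hA hP hSel
    · -- transverse condition of the root classes at the primes of `n`
      intro k n d _ _ hn hG u Q hAk hQ hQP huk ℓ hℓ
      exact ShimuraWalk.rootClass_familyData_mem_transverseKer W hK hD hp2 ι k hn (fun q' hq' ↦ (hG q' hq').1) d u Q
        hAk hQ hQP huk hℓ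
    · -- stringent membership at the two carrier places (both lie over `q`)
      intro k hn' n d hk hy hsq hG hne q₀ hq₀
      refine hstrq k hn' n d hk hy hsq hG hne q₀ ?_
      simp only [Finset.mem_insert, Finset.mem_singleton] at hq₀
      rcases hq₀ with rfl | rfl
      exacts [hqv₀, hqv₀']

end Summit.BirchSwinnertonDyer.Rank1Residual.X11b.Three.Koly

end
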